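import Summits.CriticalPhenomena.PercolationContinuityZ3.Theorems.PercNearOneGluingNoHeavyPcintClosingWordCount
import Literature.Analysis.Complex.JensenPolynomialHyperbolicity
import HarnessLib

/-!
# CriticalPhenomena/PercolationContinuityZ3 — Theorems/PercNearOneGluingNoHeavyPcintPolygonChordLaw.lean: STRUCTURE LAW C5-L1 IS A THEOREM — `polygonLeadingCoeffLaw_holds`: for every `m ≥ 2`, `2·2m·p_2m(ℤ^d)/(2d)^m → a(m)`, the number of connected chord diagrams

Lane prim-pcint, STRUCTURE rule «numerics ⇒ structure ⇒ conjecture» (prim-pcint-2 GEN 20).  The typed law `polygonLeadingCoeffLaw` of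
…PcintChordDiagramLaw (prim-pcint-2 gen 19; pre-registered as P21 and HIT at zero tolerance for `m ≤ 6`, proved there for `m ≤ 5` from the exact
polygon polynomials) is proved here for ALL `m`, by the combinatorial route assembled in the six preceding files:
* `closingCount d (2m) = Σ_j C(d,j)·fullClosingCount j (2m)` (…ClosingCountBinomial), with `fullClosingCount j (2m) = 0` for `j > m`
  (…ClosingWordStructure) and `fullClosingCount m (2m) = m!·2^m·connChord m` (…ClosingWordCount: the `2m`-gons spanning `m` axes are the
  labelled oriented irreducible chord diagrams on `2m` points, counted by the Touchard–Riordan numbers, …ChordDiagramCount), so that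
  **`2·2m·p_2m(ℤ^d) = d(d−1)⋯(d−m+1)·2^m·a(m) + Σ_{j<m} C(d,j)·fullClosingCount j (2m)`** (`closingCount_two_mul_eq`), a polynomial in `d` of
  degree `m` with leading coefficient `2^m·a(m)`;
* dividing by `(2d)^m`: `d(d−1)⋯(d−m+1)/d^m → 1` (the tree's `PolyaSchur.tendsto_descFactorial_div_pow`) and `C(d,j)/(2d)^m → 0` for `j < m`
  (`tendsto_choose_div_pow`), whence **`polygonLeadingCoeffLaw_holds : polygonLeadingCoeffLaw`**.
So the leading `1/d` behaviour of the self-avoiding-polygon counts of `ℤ^d` at every fixed length is governed by the connected chord diagrams —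
the lane's law C5-L1 (P21), now unconditional.

HONEST FRAMING: a theorem about polygon counts (the STRUCTURE programme's law C5-L1), not about a certified `p_c` cell.  No `sorry`; standard
axioms.  Written by prim-pcint-2 gen 20 (prover-prim-pcint-2-g20-0), 2026-08-26.
-/

noncomputable section

namespace Summit.CriticalPhenomena.PercolationContinuityZ3.Theorems.Pcint.MemoryTail

open Filter Topology
open scoped Nat
open Literature.Probability.LatticeModels Literature.Probability.Percolation
open Summit.CriticalPhenomena.PercolationContinuityZ3.Theorems.Pcint
open Summit.CriticalPhenomena.PercolationContinuityZ3.Theorems.Pcint.ChordDiag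

/-- **The polygon count as leading term plus lower binomial terms**:
`2·2m·p_2m(ℤ^d) = d(d−1)⋯(d−m+1)·2^m·a(m) + Σ_{j<m} C(d,j)·fullClosingCount j (2m)` (`m = k + 1`). [folklore] -/
theorem closingCount_two_mul_eq (d k : ℕ) :
    closingCount d (2 * (k + 1)) = d.descFactorial (k + 1) * 2 ^ (k + 1) * connChord (k + 1) +
      ∑ j ∈ Finset.range (k + 1), d.choose j * fullClosingCount j (2 * (k + 1)) := by
  rw [closingCount_eq_sum_choose, show 2 * (k + 1) - 1 + 1 = 2 * (k + 1) by omega,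
    ← Finset.sum_subset (Finset.range_subset_range.2 (show k + 2 ≤ 2 * (k + 1) by omega))]
  · rw [Finset.sum_range_succ, fullClosingCount_eq, Nat.descFactorial_eq_factorial_mul_choose]
    ring
  · intro j hj hj'
    rw [Finset.mem_range] at hj hj'
    rw [fullClosingCount_eq_zero_of_gt (by omega), mul_zero]

/-- `C(d,j)/(2d)^m → 0` for `j < m`. [folklore] -/
theorem tendsto_choose_div_pow {j m : ℕ} (hj : j < m) :
    Tendsto (fun d : ℕ => (d.choose j : ℝ) / ((2 : ℝ) * d) ^ m) atTop (𝓝 0) := by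
  refine tendsto_of_tendsto_of_tendsto_of_le_of_le' tendsto_const_nhds (tendsto_const_div_atTop_nhds_zero_nat 1) ?_ ?_
  · filter_upwards with d
    positivity
  · filter_upwards [Filter.eventually_ge_atTop 1] with d hd
    have hd1 : (1 : ℝ) ≤ d := by exact_mod_cast hd
    have hd0 : (0 : ℝ) < d := by linarith
    rw [div_le_div_iff₀ (by positivity) hd0, one_mul]
    calc (d.choose j : ℝ) * d ≤ (d : ℝ) ^ j * d := by
          gcongr
          exact (Nat.choose_le_pow_div j d).trans (div_le_self (by positivity) (by exact_mod_cast Nat.one_le_iff_ne_zero.2 (Nat.factorial_ne_zero j)))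
      _ = (d : ℝ) ^ (j + 1) := by ring
      _ ≤ (d : ℝ) ^ m := pow_le_pow_right₀ hd1 (by omega)
      _ ≤ ((2 : ℝ) * d) ^ m := pow_le_pow_left₀ hd0.le (by linarith) m

/-- **STRUCTURE LAW C5-L1 (P21) IS A THEOREM**: for every `m ≥ 2`, `closingCount d (2m)/(2d)^m → connChord m` as `d → ∞` — the leading
coefficient of the rooted oriented `2m`-gon count of `ℤ^d` is the number of connected chord diagrams with `m` chords. [folklore] -/
theorem polygonLeadingCoeffLaw_holds : polygonLeadingCoeffLaw := by
  intro m hm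
  obtain ⟨k, rfl⟩ : ∃ k, m = k + 1 := ⟨m - 1, by omega⟩
  -- the ratio, for `d ≥ 1`, as leading term + vanishing terms
  have key : ∀ d : ℕ, 1 ≤ d →
      (connChord (k + 1) : ℝ) * ((d.descFactorial (k + 1) : ℝ) / (d : ℝ) ^ (k + 1)) +
          ∑ j ∈ Finset.range (k + 1), (fullClosingCount j (2 * (k + 1)) : ℝ) * ((d.choose j : ℝ) / ((2 : ℝ) * d) ^ (k + 1)) =
        (closingCount d (2 * (k + 1)) : ℝ) / (2 * (d : ℝ)) ^ (k + 1) := by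
    intro d hd
    have hd0 : (d : ℝ) ≠ 0 := by exact_mod_cast (show d ≠ 0 by omega)
    rw [closingCount_two_mul_eq]
    push_cast
    rw [add_div, Finset.sum_div]
    congr 1
    · rw [mul_pow]
      field_simp
    · exact Finset.sum_congr rfl fun j _ => by ring
  have hlim : Tendsto (fun d : ℕ =>
      (connChord (k + 1) : ℝ) * ((d.descFactorial (k + 1) : ℝ) / (d : ℝ) ^ (k + 1)) +
        ∑ j ∈ Finset.range (k + 1), (fullClosingCount j (2 * (k + 1)) : ℝ) * ((d.choose j : ℝ) / ((2 : ℝ) * d) ^ (k + 1)))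
      atTop (𝓝 ((connChord (k + 1) : ℕ) : ℝ)) := by
    have h1 := (Literature.Analysis.Complex.PolyaSchur.tendsto_descFactorial_div_pow (k + 1)).const_mul (connChord (k + 1) : ℝ)
    have h2 : Tendsto (fun d : ℕ => ∑ j ∈ Finset.range (k + 1),
        (fullClosingCount j (2 * (k + 1)) : ℝ) * ((d.choose j : ℝ) / ((2 : ℝ) * d) ^ (k + 1))) atTop (𝓝 0) := by
      rw [show (0 : ℝ) = ∑ j ∈ Finset.range (k + 1), (fullClosingCount j (2 * (k + 1)) : ℝ) * 0 by simp]
      exact tendsto_finsetSum _ fun j hj => (tendsto_choose_div_pow (Finset.mem_range.1 hj)).const_mul _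
    simpa using h1.add h2
  refine hlim.congr' ?_
  filter_upwards [Filter.eventually_ge_atTop 1] with d hd
  exact key d hd

end Summit.CriticalPhenomena.PercolationContinuityZ3.Theorems.Pcint.MemoryTail
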